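import Literature.MathematicalPhysics.QuantumLattice.InfVolFermionStateGaugeAction
import HarnessLib

/-!
# Gauge charge and gauge invariance in COMMUTATOR form: `[N̂, a] = q a`, and
# `ω` gauge invariant `⟺ ω([N̂_Λ, A]) = 0` for all local `A` (the certificate-program normal form)

Topic `Literature/MathematicalPhysics/QuantumLattice` (namespace = path). Seat `hubbard-cq-p4` (cell
`pub/hubbard-cq`); transplant-1 DICTIONARY v3 §11 «`isGaugeInvariant_iff_commutator`» (support item),
sequel of `FockGaugeAction.lean` / `InfVolFermionStateGaugeAction.lean`. Everything is PROVED; no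
definition, no named fact, finite matrices and the tree's `InfVolFermionState` only.

The one-parameter gauge group `γ_θ = e^{iθN̂}(·)e^{-iθN̂}` is generated by the particle number:
`d/dθ γ_θ(a)|₀ = i[N̂, a]`. On the finite Fock spaces of the tree this becomes pure algebra:

* `totalNumberOp_commutator_apply` — `([N̂, a]) s t = (|s| − |t|) · a s t`;
* **`hasGaugeCharge_iff_commutator`** — `a` has gauge charge `q` (`γ_θ a = e^{iqθ} a`, `HasGaugeCharge`)
  iff `N̂ a − a N̂ = q • a` (the form used by the tree's `KomaTasaki.U1System.HasCharge` and by the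
  one-point certificate programs); in particular `hasGaugeCharge_zero_iff_commute` (gauge invariant
  `⟺` number conserving) and `FermionInteraction.isGaugeInvariant_iff_forall_commute` (an interaction is
  gauge invariant iff every term commutes with the local particle number);
* `gradedCompress_card_commutator_totalNumberOp` — the pinching kills every commutator with `N̂`
  (`E([N̂, a]) = 0`);
* **`InfVolFermionState.isGaugeInvariant_iff_forall_expect_commutator`** — an infinite-volume state is
  gauge invariant iff `ω_Λ(N̂_Λ A − A N̂_Λ) = 0` for every region `Λ` and every `A ∈ 𝔄_Λ` — the LINEAR
  constraint by which moment / SOS relaxations impose the `U(1)` symmetry (Kull–Schuch–Dive–Navascués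
  §3.3; the tree's `StateRelaxationKKTCharged`), and the form in which torus limits of fixed-`N`
  families are recognised as symmetric.

## References
* O. Bratteli, D. W. Robinson, *Operator Algebras and Quantum Statistical Mechanics 2*, 2nd ed. (1997),
  §5.2.2 (gauge group, its generator the number operator). [cite: BratteliRobinsonII1997, §5.2.2]
* H. Tasaki, *Physics and Mathematics of Quantum Many-Body Systems* (2020), §9.2 (`N̂` on Fock space).
  [cite: Tasaki2020, §9.2]
* I. Kull, N. Schuch, B. Dive, M. Navascués, Phys. Rev. X 14 (2024) 021008, §3.3 (symmetry constraints of
  the relaxation). [cite: KullEtAl2024, §3.3]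
-/

noncomputable section

open Matrix Finset Complex Literature.LinearAlgebra.Matrix Literature.Probability.LatticeModels

namespace Literature.MathematicalPhysics.QuantumLattice

variable {κ : Type*} [LinearOrder κ] [Fintype κ]

/-! ## The commutator with `N̂` on Fock matrices -/

/-- **`([N̂, a]) s t = (|s| − |t|) · a s t`** (`N̂ = diagonal (s ↦ |s|)`). [cite: Tasaki2020, §9.2] -/
theorem totalNumberOp_commutator_apply (a : Matrix (Finset κ) (Finset κ) ℂ) (s t : Finset κ) :
    ((totalNumberOp : Matrix (Finset κ) (Finset κ) ℂ) * a - a * (totalNumberOp : Matrix (Finset κ) (Finset κ) ℂ)) s t =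
      ((s.card : ℂ) - t.card) * a s t := by
  rw [totalNumberOp_eq_diagonal, Matrix.sub_apply, diagonal_mul, mul_diagonal]
  ring

/-- **Charge `q` in commutator form**: `γ_θ a = e^{iqθ} a` for all `θ` iff `N̂ a − a N̂ = q • a`.
[cite: BratteliRobinsonII1997, §5.2.2] -/
theorem hasGaugeCharge_iff_commutator {q : ℤ} {a : Matrix (Finset κ) (Finset κ) ℂ} :
    HasGaugeCharge q a ↔ (totalNumberOp : Matrix (Finset κ) (Finset κ) ℂ) * a - a * (totalNumberOp : Matrix (Finset κ) (Finset κ) ℂ) = (q : ℂ) • a := by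
  rw [hasGaugeCharge_iff]
  constructor
  · intro h
    ext s t
    rw [totalNumberOp_commutator_apply, Matrix.smul_apply, smul_eq_mul]
    by_cases hst : (s.card : ℤ) - t.card = q
    · rw [← hst]; push_cast; ring
    · rw [h s t hst, mul_zero, mul_zero]
  · intro h s t hst
    have hh := congrFun (congrFun h s) t
    rw [totalNumberOp_commutator_apply, Matrix.smul_apply, smul_eq_mul] at hh
    have hne : ((s.card : ℂ) - t.card) - q ≠ 0 := by
      have : (((s.card : ℤ) - t.card - q : ℤ) : ℂ) ≠ 0 := by exact_mod_cast sub_ne_zero.2 hst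
      push_cast at this
      exact this
    have h0 : (((s.card : ℂ) - t.card) - q) * a s t = 0 := by rw [sub_mul, hh, sub_self]
    exact (mul_eq_zero.1 h0).resolve_left hne

/-- **Gauge invariant `⟺` number conserving**: `HasGaugeCharge 0 a ↔ Commute N̂ a`.
[cite: BratteliRobinsonII1997, §5.2.2] -/
theorem hasGaugeCharge_zero_iff_commute {a : Matrix (Finset κ) (Finset κ) ℂ} :
    HasGaugeCharge 0 a ↔ Commute (totalNumberOp : Matrix (Finset κ) (Finset κ) ℂ) a := by
  rw [hasGaugeCharge_iff_commutator, Int.cast_zero, zero_smul, sub_eq_zero]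
  rfl

/-- `γ_θ a = a` for all `θ` iff `a` commutes with `N̂`. [cite: BratteliRobinsonII1997, §5.2.2] -/
theorem forall_gaugeAut_eq_iff_commute {a : Matrix (Finset κ) (Finset κ) ℂ} :
    (∀ θ : ℝ, gaugeAut θ a = a) ↔ Commute (totalNumberOp : Matrix (Finset κ) (Finset κ) ℂ) a := by
  rw [← hasGaugeCharge_zero_iff, hasGaugeCharge_zero_iff_commute]

/-- **The pinching kills commutators with `N̂`**: `E(N̂ a − a N̂) = 0`. [cite: Tasaki2020, §9.2] -/
theorem gradedCompress_card_commutator_totalNumberOp (a : Matrix (Finset κ) (Finset κ) ℂ) :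
    gradedCompress Finset.card ((totalNumberOp : Matrix (Finset κ) (Finset κ) ℂ) * a - a * (totalNumberOp : Matrix (Finset κ) (Finset κ) ℂ)) = 0 := by
  ext s t
  rw [gradedCompress_card_apply, totalNumberOp_commutator_apply, Matrix.zero_apply]
  split_ifs with h
  · rw [h, sub_self, zero_mul]
  · rfl

/-! ## Interactions: gauge invariant iff number conserving -/

/-- **An interaction is gauge invariant iff every term commutes with the local particle number.**
[cite: BratteliRobinsonII1997, §5.2.2] -/
theorem FermionInteraction.isGaugeInvariant_iff_forall_commute {d : ℕ} (Ψ : FermionInteraction d) :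
    Ψ.IsGaugeInvariant ↔ ∀ X : Finset (Site d), Commute (totalNumberOp : FermionOp X) (Ψ.Φ X) := by
  constructor
  · intro h X
    exact forall_gaugeAut_eq_iff_commute.1 fun θ => h θ X
  · intro h θ X
    exact forall_gaugeAut_eq_iff_commute.2 (h X) θ

/-! ## States: gauge invariant iff all commutator expectations vanish -/

namespace InfVolFermionState

variable {d : ℕ}

/-- **A gauge-invariant state annihilates every commutator with the local particle number**:
`ω_Λ(N̂_Λ A − A N̂_Λ) = 0`. [cite: BratteliRobinsonII1997, §5.2.2] -/
theorem IsGaugeInvariant.expect_commutator_totalNumberOp {ω : InfVolFermionState d} (hω : ω.IsGaugeInvariant)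
    (Λ : Finset (Site d)) (A : FermionOp Λ) :
    ω.expect Λ ((totalNumberOp : FermionOp Λ) * A - A * (totalNumberOp : FermionOp Λ)) = 0 := by
  rw [← hω.gaugeAverage_eq, gaugeAverage_expect, gradedCompress_card_commutator_totalNumberOp, map_zero]

/-- **Conversely, a state annihilating all commutators with the local particle numbers is gauge
invariant** (on a matrix unit of charge `q ≠ 0` the hypothesis reads `q · ω(|s⟩⟨t|) = 0`, so `ω`
factors through the pinching). [cite: BratteliRobinsonII1997, §5.2.2] -/
theorem isGaugeInvariant_of_forall_expect_commutator {ω : InfVolFermionState d}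
    (h : ∀ (Λ : Finset (Site d)) (A : FermionOp Λ), ω.expect Λ ((totalNumberOp : FermionOp Λ) * A - A * (totalNumberOp : FermionOp Λ)) = 0) :
    ω.IsGaugeInvariant := by
  rw [isGaugeInvariant_iff_gaugeAverage_eq]
  refine InfVolFermionState.ext fun Λ => LinearMap.ext fun A => ?_
  rw [gaugeAverage_expect]
  conv_lhs => rw [Matrix.matrix_eq_sum_single A, gradedCompress_card_sum]
  conv_rhs => rw [Matrix.matrix_eq_sum_single A]
  simp only [gradedCompress_card_sum, map_sum]
  refine Finset.sum_congr rfl fun s _ => Finset.sum_congr rfl fun t _ => ?_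
  rw [gradedCompress_of_hasGaugeCharge (hasGaugeCharge_single s t (A s t))]
  split_ifs with hq
  · rfl
  · have hst := h Λ (Matrix.single s t (A s t))
    rw [hasGaugeCharge_iff_commutator.1 (hasGaugeCharge_single s t (A s t)), map_smul, smul_eq_mul] at hst
    have hne : (((s.card : ℤ) - t.card : ℤ) : ℂ) ≠ 0 := by exact_mod_cast hq
    rw [map_zero, (mul_eq_zero.1 hst).resolve_left hne]

/-- **Gauge invariance in commutator form**: `ω` is gauge invariant iff `ω_Λ(N̂_Λ A − A N̂_Λ) = 0` for
every region `Λ` and every local `A` — transplant-1's `isGaugeInvariant_iff_commutator`, the linear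
`U(1)`-symmetry constraint of the moment / SOS relaxations. [cite: KullEtAl2024, §3.3]
[cite: BratteliRobinsonII1997, §5.2.2] -/
theorem isGaugeInvariant_iff_forall_expect_commutator (ω : InfVolFermionState d) :
    ω.IsGaugeInvariant ↔
      ∀ (Λ : Finset (Site d)) (A : FermionOp Λ), ω.expect Λ ((totalNumberOp : FermionOp Λ) * A - A * (totalNumberOp : FermionOp Λ)) = 0 :=
  ⟨fun h Λ A => h.expect_commutator_totalNumberOp Λ A, isGaugeInvariant_of_forall_expect_commutator⟩

/-- A gauge-invariant state vanishes on every charged matrix unit `|s⟩⟨t|`, `|s| ≠ |t|`.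
[cite: BratteliRobinsonII1997, §5.2.2] -/
theorem IsGaugeInvariant.expect_single_eq_zero {ω : InfVolFermionState d} (hω : ω.IsGaugeInvariant)
    (Λ : Finset (Site d)) {s t : Finset (Orb (PolySite Λ))} (hst : s.card ≠ t.card) (c : ℂ) :
    ω.expect Λ (Matrix.single s t c) = 0 :=
  hω.expect_eq_zero_of_hasGaugeCharge (sub_ne_zero.2 (by exact_mod_cast hst)) (hasGaugeCharge_single s t c)

/-- **The density matrices of a gauge-invariant state are particle-number block diagonal**:
`(ρ_Λ)_{s t} = 0` unless `|s| = |t|`. [cite: BratteliRobinsonII1997, §5.2.2] -/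
theorem IsGaugeInvariant.rdm_apply_eq_zero {ω : InfVolFermionState d} (hω : ω.IsGaugeInvariant)
    (Λ : Finset (Site d)) {s t : Finset (Orb (PolySite Λ))} (hst : s.card ≠ t.card) :
    ω.rdm Λ s t = 0 := by
  rw [rdm_apply]
  exact hω.expect_single_eq_zero Λ (Ne.symm hst) 1

/-- … i.e. `ρ_Λ` is its own particle-number pinching. [cite: KullEtAl2024, §3.3] -/
theorem IsGaugeInvariant.gradedCompress_rdm {ω : InfVolFermionState d} (hω : ω.IsGaugeInvariant)
    (Λ : Finset (Site d)) : gradedCompress Finset.card (ω.rdm Λ) = ω.rdm Λ :=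
  gradedCompress_of_graded fun _ _ hst => hω.rdm_apply_eq_zero Λ hst

end InfVolFermionState

end Literature.MathematicalPhysics.QuantumLattice

end
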